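import Summits.RiemannHypothesis.RiemannHypothesis.Theorems.UniversalFactorLaplaceLoophole
import Summits.RiemannHypothesis.RiemannHypothesis.Theorems.UniversalFactorLaplaceLoopholeKillPath
import Summits.RiemannHypothesis.RiemannHypothesis.Theorems.UniversalFactorH0DecayStandalone
import Literature.NumberTheory.LFunctions.XiIntegralLimitProofs
import Literature.NumberTheory.LFunctions.DeBruijnNewmanConstProofs

/-!
# Disproof of `LaplaceLoophole` (crux stmt-RiemannHypothesis-2575, route UniversalFactor) — findings

Standing-adversary workfile of the cdisprove seat (refuter-cdisprove-stmt-RiemannHypothesis-2575-0).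
Crux X = `UniversalFactor.LaplaceLoophole`:
  `∃ a > 0, HasOnlyRealZeros F_a`,  `F_a(z) = ∫₀^∞ Φ(u)(1 + u²/a²)⁻¹ cos(zu) du = deBruijnHDiv (1 + u²/a²) z`
(the Laplace(a)-smoothing `F_a = H_0 ∗ (a/2)e^{−a|·|}` of `H_0(z) = ξ(½ + iz/2)/8`; `H_0 = F_a − F_a''/a²`).

VERDICT SO FAR: **no kill; X resists** (cycle 1). X → RH is a theorem of the tree; ¬X is generalised
Newman off the Gaussian ray (Cardon 2002 §3 Question 7, open in print). The formal statement is
faithful (no junk zeros: the integrand is integrable for every `z`; `HasOnlyRealZeros 0` is false but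
`F_a ≢ 0`), so only the mathematics can kill it, window by window (the route's kill path
`not_laplaceLoophole_of_noGo`).

## Findings (all `sorry`-free unless marked NEAR-MISS)

* (a) LOAD-BEARING `0 < a` — `laplaceLoopholeWithoutPos_iff_riemannHypothesis`: in Lean `u²/0² = 0`,
  so `F_0 = H_0`, and `F_{-a} = F_a`; the crux with `0 < a` dropped is EXACTLY `RiemannHypothesis`.
  Hence `¬ LaplaceLoopholeWithoutPos ↔ ¬ RH`: no `_false_without_pos` theorem can exist short of
  disproving RH, and every refutation of X must use `0 < a` (it does: all four no-go windows are
  phrased for `a > 0`; at `a = 0` the "wide tail" degenerates).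
* (c) REFUTED STRENGTHENING `∃ ↦ ∀` — `not_forall_pos_hasOnlyRealZeros_laplace`:
  `¬ ∀ a > 0, HasOnlyRealZeros F_a`; sharper, `eventually_nhdsGT_not_hasOnlyRealZeros_laplace`:
  `∀ᶠ a in 𝓝[>] 0, ¬ HasOnlyRealZeros F_a` — the loophole set `{a > 0 | F_a ∈ LP}` is bounded away
  from `0`. Mechanism: the residue `C(a) = ∫₀^∞ H_0(x)cosh(ax)dx` of the tree's `wideKernelNoGo` is
  continuous at `0` (dominated convergence, Lagarias–Montague decay) with
  `C(0) = ∫₀^∞ H_0 = (π/2)Φ(0) > 0` (`integral_Ioi_deBruijnH_zero`, from Fourier inversion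
  `integral_riemannXi_criticalLine_Ioi`). This is the first UNCONDITIONAL instance of the wide no-go
  (the tree's `wideKernelNoGo` carries `C(a) ≠ 0` as a hypothesis nobody had discharged at any `a`).
* (b) BOUNDARY OF THE WIDE WINDOW — NUMERICAL (kit job j013157 + local double precision, 2026-08-16):
  `C(a) = (π/2)Φ(ia)` (Fourier inversion continued to `|Im u| < π/8`), and
  `Φ(iy) = Σ (2π²n⁴e^{9iy} − 3πn²e^{5iy}) exp(−πn²e^{4iy})` is real with
  `Φ(0) = 0.4467`, rising to `3.51` at `y = 0.28`, then CHANGING SIGN at `y₀ ≈ 0.3195 ∈ (0.31, 0.32)`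
  (`Φ(0.31i) = 1.89`, `Φ(0.32i) = −0.154`, `Φ(0.36i) = −15.2`, `Φ(0.38i) = −0.13`), and exponentially
  small (alternating-theta cusp, `≍ e^{−π/(16(π/8−y))}`) as `y → π/8⁻`. CONSEQUENCE FOR THE KILL PATH:
  `ExceptionalWideNoGo` (stmt-2583) is NOT vacuous — there is at least one exceptional wide direction
  `a₀ ≈ 0.3195` where the residue vanishes, `F_{a₀}(x) = −a₀∫₀^∞ H_0(x+v) sinh(a₀v) dv` decays like the
  main term `x^{7/4}e^{−πx/8}`, and the wide-tail mechanism says nothing; any proof there must be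
  a-UNIFORM on a neighbourhood of `a₀` (the residue is only known numerically) — e.g. one certified
  argument-principle box for `F_a`, `|a − a₀| ≤ 10⁻⁶`, plus certified signs of `Φ(ia)` elsewhere.
  Whether `Φ(iy)` has further zeros accumulating at `π/8` is being checked at 400 digits (job j013157).
  NEAR-MISS `exists_residue_zero` below records the Lean form (`∃ a ∈ (0.31, 0.33), C(a) = 0`; needs
  the continuation identity `C(a) = (π/2)Φ_ℂ(ia)` + a certified sign evaluation of the series, then IVT).
* WHY X RESISTS (per window; details in the seat's NOTES.md):
  - `0 < a < π/8`, `C(a) ≠ 0`: DEAD (tree: `wideKernelNoGo`), now unconditional near `0⁺` (this file).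
  - `a = a₀` (and any other residue zero): open; mechanism must be the band-limit/sign-change deficit of
    the Lorentzian-reweighted Riemann–Siegel sum (weights `m_n = a²/(a² + (½log(N/n) + iπ/8)²)`), whose
    power spectrum in the phase frequency `f = log(N/n)` decays like `a⁴/f⁴`: Rice heuristics give O(1)
    real sign changes per unit `t` against `(1/2π)log t` zeros — almost all zeros non-real — but a proof
    needs a certified box (finite `a`-window) or an a-uniform deficit theorem.
  - `π/8 ≤ a ≤ 32`: certified numerics (Lehmer pair γ ≈ 7005 for `6 ≤ a < 37.5`: the local quadratic
    model `p = (z−z₁)(z−z₂)` loses its real zeros under `(1 − D²/a²)⁻¹ ≈ 1 + D²/a²` iff gap `< 2√2/a`);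
    not cheap, not mine (items 2577/2582).
  - `a ≥ 32`: genuinely open. Off-axis zeros of `F_a`, if any, are MICROSCOPIC: for `σ = ½ + δ` the
    window sum is `≍ N^{−δ}` against the `n = 1` term `4a²/log²N`, so zeros off the line live in
    `|Im z| ≲ 4 log log T / log T`; Dobner's device (Gaussian weights `e^{t log²(N/n)/4}` complete the
    square into a FIXED Dirichlet series `ζ_t` at a shifted point `J_t(s)`, then Bohr almost periodicity)
    has no Lorentzian analogue (partial fractions of `m_n` just undo the smoothing); the small-gap/Lehmer
    route needs normalised gaps `μ < 0.28` infinitely often (known: `0.5154` on RH); no monotonicity in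
    `a` (`(1+u²/b²)/(1+u²/a²)` is not a universal factor either way), so nothing propagates from the
    dead windows. Note ¬RH → ¬X trivially (X → RH), so any refutation may ASSUME RH and its consequences.
* (d) TARGETS: none yet (payload `stuck_stubs = []`).

Everything conclusive here is also filed for the tree as
`Theorems/LaplaceLoophole/Negative/LaplaceLoopholeLoadBearing.lean` (`--supports stmt-RiemannHypothesis-2575`).
-/

noncomputable section

namespace Summit.RiemannHypothesis.RiemannHypothesis.Cruxes.LaplaceLoophole.Disproof

open MeasureTheory Set Filter Complex
open scoped Topology
open Literature.NumberTheory.LFunctions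
open Summit.RiemannHypothesis.RiemannHypothesis.Theses
open Summit.RiemannHypothesis.RiemannHypothesis.Theorems

/-! ## §0 The crux and its negation, restated -/

/-- The crux is `∃ a > 0, HasOnlyRealZeros (deBruijnHDiv (1 + u²/a²))` (`Iff.rfl`, tree). [folklore] -/
theorem laplaceLoophole_iff :
    UniversalFactor.LaplaceLoophole ↔
      ∃ a : ℝ, 0 < a ∧ HasOnlyRealZeros (deBruijnHDiv fun u : ℝ => 1 + u ^ 2 / a ^ 2) :=
  Iff.rfl

/-- What a kill must produce: for EVERY `a > 0` a zero of `F_a` off the real axis. [folklore] -/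
theorem not_laplaceLoophole_iff_forall_exists_zero :
    ¬ UniversalFactor.LaplaceLoophole ↔
      ∀ a : ℝ, 0 < a → ∃ z : ℂ, deBruijnHDiv (fun u : ℝ => 1 + u ^ 2 / a ^ 2) z = 0 ∧ z.im ≠ 0 := by
  rw [not_laplaceLoophole_iff]
  refine forall₂_congr fun a _ ↦ ?_
  simp only [HasOnlyRealZeros, not_forall, exists_prop]

/-! ## §1 (a) Load-bearing analysis: the side condition `0 < a` -/

/-- The crux with its only hypothesis `0 < a` dropped. [folklore] -/
def LaplaceLoopholeWithoutPos : Prop :=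
  ∃ a : ℝ, HasOnlyRealZeros (fun z : ℂ => ∫ u in Set.Ioi (0:ℝ),
    ((deBruijnPhi u / (1 + u ^ 2 / a ^ 2) : ℝ) : ℂ) * Complex.cos (z * u))

/-- In Lean `u²/0² = 0`: the Laplace multiplier at `a = 0` is `1`, so `F_0 = H_0`. [folklore] -/
theorem deBruijnHDiv_laplace_zero :
    deBruijnHDiv (fun u : ℝ => 1 + u ^ 2 / (0:ℝ) ^ 2) = deBruijnH 0 := by
  have h : (fun u : ℝ => 1 + u ^ 2 / (0:ℝ) ^ 2) = fun _ : ℝ => (1:ℝ) := by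
    funext u; simp
  rw [h]
  exact deBruijnHDiv_one'

/-- `F_{|a|} = F_a` (the family depends on `a²` only; in particular `F_{-a} = F_a`). [folklore] -/
theorem deBruijnHDiv_laplace_abs (a : ℝ) :
    deBruijnHDiv (fun u : ℝ => 1 + u ^ 2 / |a| ^ 2) = deBruijnHDiv (fun u : ℝ => 1 + u ^ 2 / a ^ 2) := by
  simp_rw [sq_abs]

/-- At the junk value `a = 0` the crux's predicate is RH itself. [folklore] -/
theorem hasOnlyRealZeros_laplace_zero_iff_riemannHypothesis :
    HasOnlyRealZeros (fun z : ℂ => ∫ u in Set.Ioi (0:ℝ),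
        ((deBruijnPhi u / (1 + u ^ 2 / (0:ℝ) ^ 2) : ℝ) : ℂ) * Complex.cos (z * u)) ↔
      _root_.RiemannHypothesis := by
  change HasOnlyRealZeros (deBruijnHDiv fun u : ℝ => 1 + u ^ 2 / (0:ℝ) ^ 2) ↔ _
  rw [deBruijnHDiv_laplace_zero]
  exact riemannHypothesis_iff_hasOnlyRealZeros_deBruijnH_zero_holds.symm

/-- **(a) `0 < a` is load-bearing: the crux WITHOUT it is exactly the Riemann hypothesis.**
(`a = 0` is the junk witness `F_0 = H_0`; any `a ≠ 0` gives the crux at `|a| > 0`, hence RH by the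
tree's Laguerre lift `UniversalFactor.riemannHypothesis_of_laplaceLoophole`.) So the would-be
`laplaceLoophole_false_without_pos` is `¬ RH` and cannot be had. [folklore] -/
theorem laplaceLoopholeWithoutPos_iff_riemannHypothesis :
    LaplaceLoopholeWithoutPos ↔ _root_.RiemannHypothesis := by
  constructor
  · rintro ⟨a, ha⟩
    rcases eq_or_ne a 0 with rfl | hne
    · exact hasOnlyRealZeros_laplace_zero_iff_riemannHypothesis.1 ha
    · refine UniversalFactor.riemannHypothesis_of_laplaceLoophole ⟨|a|, abs_pos.2 hne, ?_⟩
      change HasOnlyRealZeros (deBruijnHDiv fun u : ℝ => 1 + u ^ 2 / |a| ^ 2)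
      rw [deBruijnHDiv_laplace_abs]
      exact ha
  · intro h
    exact ⟨0, hasOnlyRealZeros_laplace_zero_iff_riemannHypothesis.2 h⟩

/-- Equivalently `LaplaceLoopholeWithoutPos ↔ (RH ∨ LaplaceLoophole)`. [folklore] -/
theorem laplaceLoopholeWithoutPos_iff_or :
    LaplaceLoopholeWithoutPos ↔ (_root_.RiemannHypothesis ∨ UniversalFactor.LaplaceLoophole) := by
  rw [laplaceLoopholeWithoutPos_iff_riemannHypothesis]
  exact ⟨Or.inl, fun h ↦ h.elim id UniversalFactor.riemannHypothesis_of_laplaceLoophole⟩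

/-- The negative form: refuting the hypothesis-free crux is refuting RH. [folklore] -/
theorem not_laplaceLoopholeWithoutPos_iff : ¬ LaplaceLoopholeWithoutPos ↔ ¬ _root_.RiemannHypothesis :=
  not_congr laplaceLoopholeWithoutPos_iff_riemannHypothesis

/-! ## §2 The residue `C(a) = ∫₀^∞ H_0(x) cosh(ax) dx` at `a = 0` -/

/-- `∫₀^∞ H_0(x) dx = (π/2) Φ(0)` (substitute `x = 2t` in `H_0(x) = ξ(½ + ix/2)/8`,
`∫₀^∞ ξ(½ + it) dt = 2πΦ(0)`, `integral_riemannXi_criticalLine_Ioi`). [cite: LagariasMontague2011, Thm. 2.1 (1)] -/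
theorem integral_Ioi_deBruijnH_zero :
    ∫ x in Ioi (0:ℝ), deBruijnH 0 (x : ℂ) = ((Real.pi / 2 * deBruijnPhi 0 : ℝ) : ℂ) := by
  set g : ℝ → ℂ := fun t ↦ riemannXi (1 / 2 + (t : ℂ) * I) / 8 with hg
  have h1 : ∀ x : ℝ, deBruijnH 0 (x : ℂ) = g (2⁻¹ * x) := by
    intro x
    rw [deBruijnH_zero_eq_holds, hg]
    congr 2
    push_cast
    ring
  simp_rw [h1]
  rw [integral_comp_mul_left_Ioi g 0 (by norm_num : (0:ℝ) < 2⁻¹), mul_zero, inv_inv]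
  have h2 : ∫ t in Ioi (0:ℝ), g t = (xiIntegralLimit : ℂ) / 8 := by
    simp only [hg]
    rw [integral_div, integral_riemannXi_criticalLine_Ioi]
  rw [h2, xiIntegralLimit]
  simp only [Complex.real_smul]
  push_cast
  ring

/-- `∫₀^∞ H_0 ≠ 0` (`Φ(0) > 0`). [folklore] -/
theorem integral_Ioi_deBruijnH_zero_ne_zero : (∫ x in Ioi (0:ℝ), deBruijnH 0 (x : ℂ)) ≠ 0 := by
  rw [integral_Ioi_deBruijnH_zero, Complex.ofReal_ne_zero]
  have hΦ : 0 < deBruijnPhi 0 := deBruijnPhi_pos_holds 0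
  positivity

/-- Continuity of the residue at `a = 0` (dominated convergence; `|H_0(x)cosh(ax)| ≤ Ce^{−πx/32}` for
`|a| ≤ π/32` from `e^{(π/16)|x|}|H_0(x)| ≤ C`). [folklore] -/
theorem continuousAt_coshIntegral_zero :
    ContinuousAt (fun a : ℝ => ∫ x in Ioi (0:ℝ), deBruijnH 0 (x : ℂ) * (Real.cosh (a * x) : ℂ)) 0 := by
  have hb : Real.pi / 16 < Real.pi / 8 := by linarith [Real.pi_pos]
  obtain ⟨C, hC⟩ := UniversalFactorStandalone.exists_exp_mul_norm_deBruijnH_zero_le hb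
  have hHc : Continuous fun x : ℝ ↦ deBruijnH 0 (x : ℂ) :=
    (differentiable_deBruijnH_holds 0).continuous.comp Complex.continuous_ofReal
  have hmeas : ∀ a : ℝ, AEStronglyMeasurable
      (fun x : ℝ ↦ deBruijnH 0 (x : ℂ) * (Real.cosh (a * x) : ℂ)) (volume.restrict (Ioi (0:ℝ))) := by
    intro a
    exact (hHc.mul (Complex.continuous_ofReal.comp (Real.continuous_cosh.comp
      (continuous_const.mul continuous_id)))).aestronglyMeasurable
  have hsmall : ∀ᶠ a in 𝓝 (0:ℝ), |a| < Real.pi / 32 := by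
    have : Iio (Real.pi / 32) ∈ 𝓝 (|(0:ℝ)|) := by
      rw [abs_zero]; exact Iio_mem_nhds (by positivity)
    exact continuous_abs.continuousAt.preimage_mem_nhds this
  refine MeasureTheory.continuousAt_of_dominated (bound := fun x : ℝ ↦ C * Real.exp (-(Real.pi / 32) * x))
    (Eventually.of_forall hmeas) ?_ ?_ ?_
  · filter_upwards [hsmall] with a ha
    refine ae_restrict_of_forall_mem measurableSet_Ioi fun x (hx : 0 < x) ↦ ?_
    rw [norm_mul, Complex.norm_real, Real.norm_eq_abs, abs_of_pos (Real.cosh_pos _)]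
    have hcosh : Real.cosh (a * x) ≤ Real.exp (Real.pi / 32 * x) := by
      rw [Real.cosh_eq]
      have h1 : Real.exp (a * x) ≤ Real.exp (Real.pi / 32 * x) :=
        Real.exp_le_exp.2 (by nlinarith [le_abs_self a])
      have h2 : Real.exp (-(a * x)) ≤ Real.exp (Real.pi / 32 * x) :=
        Real.exp_le_exp.2 (by nlinarith [neg_abs_le a])
      linarith
    have hHx : ‖deBruijnH 0 (x : ℂ)‖ ≤ C * Real.exp (-(Real.pi / 16) * x) := by
      have h := hC x
      rw [abs_of_pos hx] at h
      have he : Real.exp (Real.pi / 16 * x) * Real.exp (-(Real.pi / 16) * x) = 1 := by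
        rw [← Real.exp_add]; simp
      calc ‖deBruijnH 0 (x : ℂ)‖
          = Real.exp (Real.pi / 16 * x) * ‖deBruijnH 0 (x : ℂ)‖ * Real.exp (-(Real.pi / 16) * x) := by
            rw [mul_comm (Real.exp _), mul_assoc, he, mul_one]
        _ ≤ C * Real.exp (-(Real.pi / 16) * x) :=
            mul_le_mul_of_nonneg_right h (Real.exp_pos _).le
    have hC0 : 0 ≤ C := le_trans (by positivity) (hC 0)
    calc ‖deBruijnH 0 (x : ℂ)‖ * Real.cosh (a * x)
        ≤ C * Real.exp (-(Real.pi / 16) * x) * Real.exp (Real.pi / 32 * x) :=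
          mul_le_mul hHx hcosh (Real.cosh_pos _).le (by positivity)
      _ = C * Real.exp (-(Real.pi / 32) * x) := by
          rw [mul_assoc, ← Real.exp_add]; ring_nf
  · exact ((exp_neg_integrableOn_Ioi 0 (by positivity : (0:ℝ) < Real.pi / 32)).const_mul C).congr
      (ae_of_all _ fun x ↦ by ring_nf)
  · refine ae_of_all _ fun x ↦ ?_
    exact (continuous_const.mul (Complex.continuous_ofReal.comp (Real.continuous_cosh.comp
      (continuous_id.mul continuous_const)))).continuousAt

/-- **(b) Boundary: the residue is non-zero near `a = 0`** (`C(0) = (π/2)Φ(0) ≠ 0` and continuity);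
numerically it stays positive up to `a₀ ≈ 0.3195` and is NEGATIVE on `(a₀, π/8)` up to the cusp. [folklore] -/
theorem eventually_coshIntegral_ne_zero :
    ∀ᶠ a in 𝓝 (0:ℝ), (∫ x in Ioi (0:ℝ), deBruijnH 0 (x : ℂ) * (Real.cosh (a * x) : ℂ)) ≠ 0 := by
  have h0 : (∫ x in Ioi (0:ℝ), deBruijnH 0 (x : ℂ) * (Real.cosh ((0:ℝ) * x) : ℂ)) ≠ 0 := by
    simp only [zero_mul, Real.cosh_zero, Complex.ofReal_one, mul_one]
    exact integral_Ioi_deBruijnH_zero_ne_zero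
  exact continuousAt_coshIntegral_zero.eventually_ne h0

/-! ## §3 (c) Refuted strengthenings of the crux -/

/-- **All sufficiently wide smoothings fail**: `∀ᶠ a in 𝓝[>] 0, F_a ∉ LP` — the loophole set is
bounded away from `0` (tree `wideKernelNoGo` + `eventually_coshIntegral_ne_zero`). [folklore] -/
theorem eventually_nhdsGT_not_hasOnlyRealZeros_laplace :
    ∀ᶠ a in 𝓝[>] (0:ℝ), ¬ HasOnlyRealZeros (fun z : ℂ => ∫ u in Set.Ioi (0:ℝ),
      ((deBruijnPhi u / (1 + u ^ 2 / a ^ 2) : ℝ) : ℂ) * Complex.cos (z * u)) := by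
  have h1 : ∀ᶠ a in 𝓝[>] (0:ℝ), (∫ x in Ioi (0:ℝ), deBruijnH 0 (x : ℂ) * (Real.cosh (a * x) : ℂ)) ≠ 0 :=
    eventually_nhdsWithin_of_eventually_nhds eventually_coshIntegral_ne_zero
  have h2 : ∀ᶠ a in 𝓝[>] (0:ℝ), 0 < a := eventually_mem_nhdsWithin
  have h3 : ∀ᶠ a in 𝓝[>] (0:ℝ), a < Real.pi / 8 :=
    eventually_nhdsWithin_of_eventually_nhds (Iio_mem_nhds (by positivity))
  filter_upwards [h1, h2, h3] with a ha1 ha2 ha3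
  exact UniversalFactorStandalone.wideKernelNoGo a ha2 ha3 ha1

/-- **Strengthening `∃ ↦ ∀` refuted**: `¬ ∀ a > 0, HasOnlyRealZeros F_a`. [folklore] -/
theorem not_forall_pos_hasOnlyRealZeros_laplace :
    ¬ ∀ a : ℝ, 0 < a → HasOnlyRealZeros (fun z : ℂ => ∫ u in Set.Ioi (0:ℝ),
      ((deBruijnPhi u / (1 + u ^ 2 / a ^ 2) : ℝ) : ℂ) * Complex.cos (z * u)) := by
  intro h
  have h2 : ∀ᶠ a in 𝓝[>] (0:ℝ), 0 < a := eventually_mem_nhdsWithin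
  obtain ⟨a, ha, hna⟩ := (h2.and eventually_nhdsGT_not_hasOnlyRealZeros_laplace).exists
  exact hna (h a ha)

/-- **Strengthening "a whole initial segment of wide kernels is LP" refuted** in the strong form:
there is `δ > 0` such that NO `a ∈ (0, δ)` realises the loophole. [folklore] -/
theorem exists_pos_forall_lt_not_hasOnlyRealZeros_laplace :
    ∃ δ : ℝ, 0 < δ ∧ ∀ a : ℝ, 0 < a → a < δ → ¬ HasOnlyRealZeros (fun z : ℂ => ∫ u in Set.Ioi (0:ℝ),
      ((deBruijnPhi u / (1 + u ^ 2 / a ^ 2) : ℝ) : ℂ) * Complex.cos (z * u)) := by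
  obtain ⟨δ, hδ, h⟩ := mem_nhdsGT_iff_exists_Ioo_subset.1
    eventually_nhdsGT_not_hasOnlyRealZeros_laplace
  exact ⟨δ, hδ, fun a ha hlt ↦ h ⟨ha, hlt⟩⟩

/-! ## §4 NEAR-MISSES (the only `sorry`s of this file) -/

/-- NEAR-MISS (b, boundary of the wide window): **there is an exceptional wide direction** — some
`a ∈ (0.31, 0.33)` with vanishing residue, so `ExceptionalWideNoGo` is not vacuous and `wideKernelNoGo`
does not cover `(0, π/8)`. NUMERICAL EVIDENCE: `C(a) = (π/2)Φ(ia)`, `Φ(0.31i) = +1.89`,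
`Φ(0.32i) = −0.154` (double precision; 40-digit root `a₀` from kit job j013157). OBSTRUCTION to a Lean
proof: (i) the continuation identity `∫₀^∞ H_0(x)cosh(ax)dx = (π/2)Φ_ℂ(ia)` for `|a| < π/8` (Fourier
inversion at real frequencies is in the tree, `fourier_deBruijnPhi`; needs a complex-argument `Φ_ℂ`,
analyticity of both sides on the strip and the identity theorem), (ii) a certified sign of the
8-term theta series at `y = 0.31, 0.33` (interval `exp`/`cos` bounds), then IVT via
`continuousOn` of the residue on `[0, π/8)` (same domination as `continuousAt_coshIntegral_zero`).
Tried: nothing formal yet (cycle 1). [folklore] -/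
theorem exists_residue_zero :
    ∃ a : ℝ, 0.31 < a ∧ a < 0.33 ∧
      (∫ x in Ioi (0:ℝ), deBruijnH 0 (x : ℂ) * (Real.cosh (a * x) : ℂ)) = 0 := by
  sorry

/-- NEAR-MISS (the kill itself): `¬ LaplaceLoophole`. OBSTRUCTION: the three open windows of the kill
path (`NarrowKernelNoGo` a ≥ 32 — open mathematics, microscopic off-axis zeros, no Dobner analogue;
`MediumKernelNoGo` π/8 ≤ a ≤ 32 and the exceptional direction(s) `a₀ ≈ 0.3195` — certified numerics
not yet run). What IS closed: `0 < a < π/8` with `C(a) ≠ 0` (tree), unconditionally for all small `a`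
(this file). Kept as the standing statement of the target; do not cite. [folklore] -/
theorem not_laplaceLoophole : ¬ UniversalFactor.LaplaceLoophole := by
  sorry

end Summit.RiemannHypothesis.RiemannHypothesis.Cruxes.LaplaceLoophole.Disproof
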